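import Mathlib
import HarnessLib
import Summits.ResolutionOfSingularities.ResolutionOfSingularities.Theorems.WildQuotientsWildQuotientResolutionBlowupExitVertexPresentation
import Summits.ResolutionOfSingularities.ResolutionOfSingularities.Theorems.WildQuotientsWildQuotientResolutionJordanFiveI12Stable
import Summits.ResolutionOfSingularities.ResolutionOfSingularities.Theorems.WildQuotientsWildQuotientResolutionJordanFiveChartW1Defs
import Summits.ResolutionOfSingularities.ResolutionOfSingularities.Theorems.WildQuotientsWildQuotientResolutionToricExitJordanThreeBrickNonempty
import Summits.ResolutionOfSingularities.ResolutionOfSingularities.Theorems.WildQuotientsWildQuotientResolutionAffineQuotientData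
import Literature.AlgebraicGeometry.Resolution.BlowupsEquivariant
import Literature.AlgebraicGeometry.Resolution.AffineBlowupCartier

/-!
# RUNG V5: the `μ₃` cone brick `HP₁` of the J₅ scaffold (at `W₁ := chartW₁`) from a ring-level brick `H₁`
(crux stmt-ResolutionOfSingularities-15640 `WildQuotients.WildQuotientResolution`, line `Sketch`;
chain w45c RUNG V5, scaffold `JordanFive.jordanFive_hasResolution_of_bricks` (p527978, brick `HP₁`
of `L/res-L1-w45c-lead-1/stubs/J5Bricks.lean`), `CHAIN.md` v8.2 §0 («HP₁ = stub-2 ring side ⊕ stub-1 final»); [OURS · L1 W4.5c]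
— NOT a statement of any manuscript; replaces the role of no printed item. Lead res-L1-w45c-lead-1.)

`JordanFive.coneBrick_one_of_ringBrick`: the scheme-level brick `HP₁` of the scaffold at the W₁ TERM OF RECORD
`W₁ := chartW₁` (`D₊(H′²t) ⊓ D₊(T′²H′t²)`, res-L1-w45c-stub-1 p526168; `chartW₁_eq_inf`) — «some blow-up of `W₁/G` along the reduced
image of the `μ₃` vertex curve `vertexCurve 1` is regular» — from the RING-LEVEL brick `H₁` (binder below; the V4U pattern
`JordanFour.coneBrick_T_of_ringBrick`, p508076): for the chart ratios `T_j = π^*g_j / π^*H′²` on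
`V[H′²] ⊇ W₁` (`j ≠ 1`), a presentation `ψ : R₀ → Γ(O)` of the invariant ring (injective,
`range ψ = Γ(O)^G`), a radical `J₀` with regular affine blow-up and
`√(ψ⁻¹⟨π^*x_a, π^*x_b, π^*x_c, π^*x_d, T_j⟩) = J₀`. Transfer:
`BlowupExit.exists_isBlowup_regular_of_vertexPresentation` (p505172), `W₁ ≤ V[H′²]` by
`chartW₁_eq_inf` + `affineBlowup.image_top_chartι` + `affineBlowup_chartOpen_le_blowupChart`.
-/

-- single-problem summit: the doubled namespace component `ResolutionOfSingularities` is forced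
set_option linter.dupNamespace false

noncomputable section

open CategoryTheory AlgebraicGeometry TopologicalSpace MvPolynomial
open Literature.AlgebraicGeometry.Resolution Literature.AlgebraicGeometry.RelativeSpec

namespace Summit.ResolutionOfSingularities.ResolutionOfSingularities.Theorems.WildQuotientResolution.JordanFive

-- the statements are long (literal binder types of the scaffold); elaboration needs head-room
set_option maxHeartbeats 4000000 in
/-- **The `μ₃` cone brick `HP₁` of the RUNG V5 scaffold (at `W₁ := chartW₁`) from the
ring-level brick `H₁`** (see the module docstring). [OURS · L1 W4.5c]
[folklore; assembly of landed decls] -/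
theorem coneBrick_one_of_ringBrick (p : ℕ) (_hp : p.Prime) (_hp5 : 5 ≤ p)
    (k : Type) [Field k] [CharP k p] (n : ℕ)
    (σ : MvPolynomial (Fin n) k ≃ₐ[k] MvPolynomial (Fin n) k) [Finite ↥(Subgroup.zpowers σ)]
    (a b c d e : Fin n) (hab : a ≠ b) (hac : a ≠ c) (had : a ≠ d) (hae : a ≠ e) (hbc : b ≠ c)
    (hbd : b ≠ d) (hcd : c ≠ d)
    (hb : σ (X b) = X b + X a) (hc : σ (X c) = X c + X b) (hd : σ (X d) = X d + X c)
    (hσ : ∀ i, i ≠ b → i ≠ c → i ≠ d → i ≠ e → σ (X i) = X i)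
    (H₁ : ∀ (ρ : ↥(Subgroup.zpowers σ) →* Aut (Spec (CommRingCat.of (MvPolynomial (Fin n) k))))
      (hρ : ∀ g : ↥(Subgroup.zpowers σ), (ρ g).hom = Spec.map (CommRingCat.ofHom
        ((MulSemiringAction.toRingEquiv (↥(Subgroup.zpowers σ)) (MvPolynomial (Fin n) k) g⁻¹ :
          MvPolynomial (Fin n) k ≃+* MvPolynomial (Fin n) k) :
            MvPolynomial (Fin n) k →+* MvPolynomial (Fin n) k)))
      (ρB : ActionOver
        (affineBlowup.π (I12 k n a b c d) ≫
          Spec.map (CommRingCat.ofHom (algebraMap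
            (FixedPoints.subalgebra k (MvPolynomial (Fin n) k) (Subgroup.zpowers σ))
            (MvPolynomial (Fin n) k))))
        ↥(Subgroup.zpowers σ))
      (_ : ρB.aut = (affineBlowup.isBlowup (I12 k n a b c d)).liftAction ρ
        (idealSheaf_I12_comap k n a b c d hab hac had hbc hbd hcd σ (hσ a hab hac had hae) hb hc hd
          ρ hρ))
      (O : ρB.StableAffineOpens) (_ : O.1 = chartW₁ k n a b c d)
      (hle : ((O.1.ι ≫ affineBlowup.π (I12 k n a b c d) ≫
          Spec.map (CommRingCat.ofHom (algebraMap
            (FixedPoints.subalgebra k (MvPolynomial (Fin n) k) (Subgroup.zpowers σ))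
            (MvPolynomial (Fin n) k)))) ⁻¹ᵁ ⊤ : (O.1 : Scheme.{0}).Opens) ≤
        O.1.ι ⁻¹ᵁ blowupChart (affineBlowup.π (I12 k n a b c d))
          (affineBlowup.idealSheaf (I12 k n a b c d)) ⟨⊤, isAffineOpen_top _⟩
          ((Scheme.ΓSpecIso (CommRingCat.of (MvPolynomial (Fin n) k))).inv.hom (JordanFour.hPrime k n a b c ^ 2)))
      (T : {j : Fin 40 // j ≠ 1} →
        Γ(affineBlowup (I12 k n a b c d), blowupChart (affineBlowup.π (I12 k n a b c d))
          (affineBlowup.idealSheaf (I12 k n a b c d)) ⟨⊤, isAffineOpen_top _⟩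
          ((Scheme.ΓSpecIso (CommRingCat.of (MvPolynomial (Fin n) k))).inv.hom (JordanFour.hPrime k n a b c ^ 2))))
      (_ : ∀ j, (affineBlowup.π (I12 k n a b c d)).appLE ⊤
            (blowupChart (affineBlowup.π (I12 k n a b c d))
              (affineBlowup.idealSheaf (I12 k n a b c d)) ⟨⊤, isAffineOpen_top _⟩
              ((Scheme.ΓSpecIso (CommRingCat.of (MvPolynomial (Fin n) k))).inv.hom (JordanFour.hPrime k n a b c ^ 2)))
            (blowupChart_le_preimage _ _ _ _)
            ((Scheme.ΓSpecIso (CommRingCat.of (MvPolynomial (Fin n) k))).inv.hom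
              (gens12 k n a b c d j.1)) =
          (affineBlowup.π (I12 k n a b c d)).appLE ⊤
            (blowupChart (affineBlowup.π (I12 k n a b c d))
              (affineBlowup.idealSheaf (I12 k n a b c d)) ⟨⊤, isAffineOpen_top _⟩
              ((Scheme.ΓSpecIso (CommRingCat.of (MvPolynomial (Fin n) k))).inv.hom (JordanFour.hPrime k n a b c ^ 2)))
            (blowupChart_le_preimage _ _ _ _)
            ((Scheme.ΓSpecIso (CommRingCat.of (MvPolynomial (Fin n) k))).inv.hom (JordanFour.hPrime k n a b c ^ 2)) * T j),
      ∃ (R₀ : Type) (_ : CommRing R₀) (J₀ : Ideal R₀)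
        (ψ : R₀ →+* Γ((O.1 : Scheme.{0}), (O.1.ι ≫ affineBlowup.π (I12 k n a b c d) ≫
          Spec.map (CommRingCat.ofHom (algebraMap
            (FixedPoints.subalgebra k (MvPolynomial (Fin n) k) (Subgroup.zpowers σ))
            (MvPolynomial (Fin n) k)))) ⁻¹ᵁ ⊤)),
        Function.Injective ψ ∧ ψ.range = (ρB.restrict O.1 O.2.1).invariantsRing ⊤ ∧
        J₀.IsRadical ∧ Scheme.IsRegular (affineBlowup J₀) ∧
        ((Ideal.span ((O.1.ι.appLE
            (blowupChart (affineBlowup.π (I12 k n a b c d))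
              (affineBlowup.idealSheaf (I12 k n a b c d)) ⟨⊤, isAffineOpen_top _⟩
              ((Scheme.ΓSpecIso (CommRingCat.of (MvPolynomial (Fin n) k))).inv.hom (JordanFour.hPrime k n a b c ^ 2)))
            ((O.1.ι ≫ affineBlowup.π (I12 k n a b c d) ≫
              Spec.map (CommRingCat.ofHom (algebraMap
                (FixedPoints.subalgebra k (MvPolynomial (Fin n) k) (Subgroup.zpowers σ))
                (MvPolynomial (Fin n) k)))) ⁻¹ᵁ ⊤) hle) ''
          (((affineBlowup.π (I12 k n a b c d)).appLE ⊤
              (blowupChart (affineBlowup.π (I12 k n a b c d))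
                (affineBlowup.idealSheaf (I12 k n a b c d)) ⟨⊤, isAffineOpen_top _⟩
                ((Scheme.ΓSpecIso (CommRingCat.of (MvPolynomial (Fin n) k))).inv.hom (JordanFour.hPrime k n a b c ^ 2)))
              (blowupChart_le_preimage _ _ _ _)) ''
            ((Scheme.ΓSpecIso (CommRingCat.of (MvPolynomial (Fin n) k))).inv ''
              {X a, X b, X c, X d}) ∪ Set.range T))).comap ψ).radical = J₀) :
    ∀ (ρ : ↥(Subgroup.zpowers σ) →* Aut (Spec (CommRingCat.of (MvPolynomial (Fin n) k))))
      (hρ : ∀ g : ↥(Subgroup.zpowers σ), (ρ g).hom = Spec.map (CommRingCat.ofHom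
        ((MulSemiringAction.toRingEquiv (↥(Subgroup.zpowers σ)) (MvPolynomial (Fin n) k) g⁻¹ :
          MvPolynomial (Fin n) k ≃+* MvPolynomial (Fin n) k) :
            MvPolynomial (Fin n) k →+* MvPolynomial (Fin n) k)))
      (ρB : ActionOver
        (affineBlowup.π (I12 k n a b c d) ≫
          Spec.map (CommRingCat.ofHom (algebraMap
            (FixedPoints.subalgebra k (MvPolynomial (Fin n) k) (Subgroup.zpowers σ))
            (MvPolynomial (Fin n) k))))
        ↥(Subgroup.zpowers σ))
      (_ : ρB.aut = (affineBlowup.isBlowup (I12 k n a b c d)).liftAction ρ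
        (idealSheaf_I12_comap k n a b c d hab hac had hbc hbd hcd σ (hσ a hab hac had hae) hb hc hd
          ρ hρ))
      (O : ρB.StableAffineOpens) (_ : O.1 = chartW₁ k n a b c d)
      (Z : Closeds (ρB.pieceQuot O)),
      (Z : Set (ρB.pieceQuot O)) =
        (ρB.pieceMk O).base '' (O.1.ι.base ⁻¹' vertexCurve k n a b c d 1) →
      ∃ (B : Scheme.{0}) (pB : B ⟶ ρB.pieceQuot O),
        IsBlowup pB (Scheme.IdealSheafData.vanishingIdeal Z) ∧ Scheme.IsRegular B := by
  classical
  -- notation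
  let S : Type := MvPolynomial (Fin n) k
  let I : Ideal S := I12 k n a b c d
  have hπ : IsBlowup (affineBlowup.π I) (affineBlowup.idealSheaf I) := affineBlowup.isBlowup I
  let ι₀ : S →+* Γ(Spec (CommRingCat.of S), ⊤) := (Scheme.ΓSpecIso (CommRingCat.of S)).inv.hom
  have hIdeal : (affineBlowup.idealSheaf I).ideal ⟨⊤, isAffineOpen_top _⟩ = I.map ι₀ := by
    change (Scheme.IdealSheafData.ofIdealTop _).ideal ⟨⊤, isAffineOpen_top _⟩ = _
    rw [ideal_ofIdealTop_top]
  have hgj : ∀ j : Fin 40, ι₀ (gens12 k n a b c d j) ∈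
      (affineBlowup.idealSheaf I).ideal ⟨⊤, isAffineOpen_top _⟩ :=
    fun j => by rw [hIdeal]; exact Ideal.mem_map_of_mem _ (gens12_mem_I12 k n a b c d j)
  haveI : IsAffine (Spec (CommRingCat.of
    (FixedPoints.subalgebra k (MvPolynomial (Fin n) k) (Subgroup.zpowers σ)))) := inferInstance
  have hu : ι₀ (JordanFour.hPrime k n a b c ^ 2) ∈ (affineBlowup.idealSheaf I).ideal ⟨⊤, isAffineOpen_top _⟩ := by
    rw [hIdeal]; exact Ideal.mem_map_of_mem _ (hPrime_sq_mem_I12 k n a b c d)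
  -- `W₁ ⊆ V[H′²]`
  have hWle : chartW₁ k n a b c d ≤ blowupChart (affineBlowup.π I) (affineBlowup.idealSheaf I)
      ⟨⊤, isAffineOpen_top _⟩ (ι₀ (JordanFour.hPrime k n a b c ^ 2)) := by
    rw [chartW₁_eq_inf]
    refine inf_le_left.trans ?_
    rw [← affineBlowup.image_top_chartι]
    exact BlowupExit.affineBlowup_chartOpen_le_blowupChart _ _
  intro ρ hρ ρB haut O hO Z hZ
  haveI : IsSeparated (affineBlowup.π I ≫ Spec.map (CommRingCat.ofHom (algebraMap
      (FixedPoints.subalgebra k (MvPolynomial (Fin n) k) (Subgroup.zpowers σ))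
      (MvPolynomial (Fin n) k)))) := inferInstance
  have hOle : O.1 ≤ blowupChart (affineBlowup.π I) (affineBlowup.idealSheaf I)
      ⟨⊤, isAffineOpen_top _⟩ (ι₀ (JordanFour.hPrime k n a b c ^ 2)) := hO ▸ hWle
  have hle : ((O.1.ι ≫ affineBlowup.π I ≫ Spec.map (CommRingCat.ofHom (algebraMap
      (FixedPoints.subalgebra k (MvPolynomial (Fin n) k) (Subgroup.zpowers σ))
      (MvPolynomial (Fin n) k)))) ⁻¹ᵁ ⊤ : (O.1 : Scheme.{0}).Opens) ≤
      O.1.ι ⁻¹ᵁ blowupChart (affineBlowup.π I) (affineBlowup.idealSheaf I)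
        ⟨⊤, isAffineOpen_top _⟩ (ι₀ (JordanFour.hPrime k n a b c ^ 2)) := by
    intro x _
    rw [Scheme.Hom.mem_preimage]
    apply hOle
    have hx : O.1.ι.base x ∈ Set.range O.1.ι.base := ⟨x, rfl⟩
    rw [Scheme.Opens.range_ι] at hx
    exact hx
  exact BlowupExit.exists_isBlowup_regular_of_vertexPresentation hπ _ ρB hu
    (fun j : {j : Fin 40 // j ≠ 1} => ι₀ (gens12 k n a b c d j.1)) (fun j => hgj j.1)
    {X a, X b, X c, X d} O hOle hle (H₁ ρ hρ ρB haut O hO hle) Z hZ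

end Summit.ResolutionOfSingularities.ResolutionOfSingularities.Theorems.WildQuotientResolution.JordanFive

end
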